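import Summits.NavierStokesRegularity.NavierStokesRegularity.Theorems.TautLoopKelvinTautCompressionIntegrableSummitEquivalenceLawOnly
import Summits.NavierStokesRegularity.NavierStokesRegularity.Theorems.TautLoopKelvinTautLoopLaw
import HarnessLib

/-!
# `TautLoopKelvin.TautCompressionIntegrable` (stmt-NavierStokesRegularity-15248) — the RATE SPLIT
  `TautCompressionIntegrable ⇐ NoTypeIBlowup ∧ NoTypeII`, certified exact

Strategist file for the crux K1 = `Theses.TautLoopKelvin.TautCompressionIntegrable` of route
`route-NavierStokesRegularity-TautLoopKelvin`, supporting the typed decomposition (BC2 redirect)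

  K1 ⇐ `Theses.TypeICertificateLadder.NoTypeIBlowup` (stmt-NavierStokesRegularity-1217)
     ∧ `Theses.TypeICertificateLadder.NoTypeII`     (stmt-NavierStokesRegularity-0056).

Contents (no statement of any route is asserted; everything is an implication between items or a
per-solution theorem):

* `hasSmoothExtensionPast_of_tautCompression` — the PER-SOLUTION CRITERION behind the route: a classical
  solution of unforced Navier–Stokes on `ℝ³ × [0,T)`, Leray–Hopf on `[0,T]` from a rapidly decaying datum,
  whose near-taut compression rate `Λ_g` admits an integrable measurable majorant on `(0,T)` at every level
  `g > 0`, extends classically past `T`.  This is the body of the route's deciding theorem `closes` run for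
  ONE solution, with its two other cruxes discharged by the landed theorems
  `Theorems.tautLoopKelvin_tautLoopLaw_proof` (stmt-15249) and `Theorems.circulationFloor_proof` (stmt-1538).
* the split's ASSEMBLY `NoTypeIBlowup → NoTypeII → K1` is the landed
  `SummitEquivalence.tautCompressionIntegrable_of_noTypeIBlowup_of_noTypeII` (cited by the route edit; not
  restated here).
* `noTypeIBlowup_of_tautCompressionIntegrable`, `noTypeII_of_tautCompressionIntegrable`,
  `tautCompressionIntegrable_iff_noTypeIBlowup_and_noTypeII` — the split is EXACT: the two pieces are
  jointly equivalent to K1 (hence, by `SummitEquivalence`, to the summit); neither piece alone is known to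
  give K1 (Type-I exclusion and Type-II exclusion are the two classical open halves).
* `noTypeIBlowup_of_typeIEndgame`, `noTypeII_of_nonTypeIEndgame` and the two `iff`s — the pieces ARE the
  two singular regimes of the registered birth skeleton of K1 (`Cruxes/TautCompressionIntegrable/Lines/
  birth.lean`, stubs `stub_typeIBlowup_endgame` / `stub_nonTypeIBlowup_endgame`): each regime stub is
  equivalent to the corresponding rate item, the forward directions being the landed
  `Birth.typeIBlowup_endgame_of_noTypeIBlowup` / `Birth.nonTypeIBlowup_endgame_of_noTypeII` and the
  backward directions the per-solution criterion.
-/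

noncomputable section

open MeasureTheory Set
open Literature.Analysis.FluidPDE

namespace Summit.NavierStokesRegularity.NavierStokesRegularity.Theorems.TautCompressionIntegrable.Split

open Summit.NavierStokesRegularity.NavierStokesRegularity

set_option linter.dupNamespace false

/-- **Per-solution criterion (the route's mechanism for one solution).** Let `u` be a classical solution of
unforced Navier–Stokes on `ℝ³ × [0,T)`, Leray–Hopf on `[0,T]` from a rapidly decaying datum. If for every
level `g > 0` the near-taut compression rate `Λ_g(s)` has a measurable majorant `Φ` on `(0,T)` with
`∫⁻_(0,T) Φ⁺ ≤ M < ∞`, then `u` extends classically past `T`.  Proof: otherwise the landed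
`CirculationFloor` (`Theorems.circulationFloor_proof`) gives, at the quantum level `g = c₀ν`, a planar circle
of radius `r ≤ ρ/(8π)` at some `t < T` carrying circulation `≥ g`, where `ρ := (g / sup|u₀|)·e^{-M}`; the
landed `TautLoopLaw` (`Theorems.tautLoopKelvin_tautLoopLaw_proof`) from `0` to `t` gives
`ℓ(g,t) ≥ ℓ(g,0)·e^{-M} ≥ ρ` (every admissible loop at time `0` has length `≥ g / sup|u₀|`), while the circle
bounds `ℓ(g,t) ≤ 4πr ≤ ρ/2` — contradiction. [folklore] -/
theorem hasSmoothExtensionPast_of_tautCompression {ν T : ℝ} (hν : 0 < ν) (hT : 0 < T)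
    {u : ℝ → EuclideanSpace ℝ (Fin 3) → EuclideanSpace ℝ (Fin 3)} {p : ℝ → EuclideanSpace ℝ (Fin 3) → ℝ}
    (hcl : IsClassicalNSSolutionOn (Set.Ico 0 T) ν 0 u p) (hLH : IsLerayHopfOn T ν 0 (u 0) u)
    (hdec : HasRapidSpatialDecay (u 0))
    (hconcl : ∀ g : ℝ, 0 < g → ∃ (Φ : ℝ → ℝ) (M : ℝ), Measurable Φ ∧ 0 ≤ M ∧
      (∀ s ∈ Set.Ioo 0 T, (⨅ ε : {ε : ℝ // 0 < ε}, sSup {k : ℝ | ∃ γ : ℝ → EuclideanSpace ℝ (Fin 3),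
        Literature.Analysis.FluidPDE.IsC1Loop γ ∧ g ≤ |Literature.Analysis.FluidPDE.circulation (u s) γ| ∧
        ENNReal.ofReal (∫ σ in (0:ℝ)..1, ‖deriv γ σ‖) ≤
          (⨅ (γ' : ℝ → EuclideanSpace ℝ (Fin 3)) (_ : Literature.Analysis.FluidPDE.IsC1Loop γ' ∧
            g ≤ |Literature.Analysis.FluidPDE.circulation (u s) γ'|), ENNReal.ofReal (∫ σ in (0:ℝ)..1, ‖deriv γ' σ‖)) +
          ENNReal.ofReal (ε : ℝ) ∧
        k = ((∫ σ in (0:ℝ)..1, -(inner ℝ (deriv γ σ) (fderiv ℝ (u s) (γ σ) (deriv γ σ))) / ‖deriv γ σ‖) /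
          (∫ σ in (0:ℝ)..1, ‖deriv γ σ‖))}) ≤ Φ s) ∧
      (∫⁻ s in Set.Ioo 0 T, ENNReal.ofReal (Φ s)) ≤ ENNReal.ofReal M) :
    HasSmoothExtensionPast ν 0 u T := by
  by_contra hext
  obtain ⟨c₀, hc₀, hF⟩ := Theorems.circulationFloor_proof
  have hgpos : 0 < c₀ * ν := mul_pos hc₀ hν
  -- a sup bound for the datum from rapid decay (n = 0, K = 0)
  obtain ⟨C₀, hC₀⟩ := hdec 0 0
  have hu0 : ∀ x, ‖u 0 x‖ ≤ max C₀ 1 := by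
    intro x
    have h := hC₀ x
    rw [pow_zero, one_mul, norm_iteratedFDeriv_zero] at h
    exact h.trans (le_max_left _ _)
  have hCpos : 0 < max C₀ 1 := lt_of_lt_of_le one_pos (le_max_right _ _)
  -- the hypothesis at the quantum level g = c₀ ν
  obtain ⟨Φ, M, hΦ, hM, hmaj, hint⟩ := hconcl (c₀ * ν) hgpos
  -- the radius floor
  set ρ : ℝ := (c₀ * ν / max C₀ 1) * Real.exp (-M) with hρ
  have hρpos : 0 < ρ := mul_pos (div_pos hgpos hCpos) (Real.exp_pos _)
  -- the Floor: a small circle carrying the quantum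
  obtain ⟨t, ht, c, e₁, e₂, r, hr, hrδ, he₁, he₂, he12, hcirc⟩ :=
    hF ν T hν hT u p hcl hLH hdec hext (ρ / (8 * Real.pi)) (div_pos hρpos (by positivity))
  -- the taut-loop law from 0 to t at level g
  have hlaw := Theorems.tautLoopKelvin_tautLoopLaw_proof ν T hν hT u p hcl hLH hdec (c₀ * ν) hgpos 0 t
    le_rfl ht.1 ht.2 Φ M hΦ hM (fun s hs => hmaj s ⟨hs.1, hs.2.trans ht.2⟩)
    ((MeasureTheory.lintegral_mono_set (Set.Ioo_subset_Ioo le_rfl ht.2.le)).trans hint)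
  -- the circle is admissible at time t, so the spectrum at t is below its length
  set γc : ℝ → EuclideanSpace ℝ (Fin 3) := Literature.Analysis.FluidPDE.circleLoop c r e₁ e₂ with hγc
  have hadm : Literature.Analysis.FluidPDE.IsC1Loop γc ∧
      c₀ * ν ≤ |Literature.Analysis.FluidPDE.circulation (u t) γc| := by
    refine ⟨Literature.Analysis.FluidPDE.isC1Loop_circleLoop c r e₁ e₂, ?_⟩
    rw [hγc, Literature.Analysis.FluidPDE.circulation_circleLoop]
    exact hcirc
  have hupper : (⨅ (γ' : ℝ → EuclideanSpace ℝ (Fin 3)) (_ : Literature.Analysis.FluidPDE.IsC1Loop γ' ∧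
      c₀ * ν ≤ |Literature.Analysis.FluidPDE.circulation (u t) γ'|), ENNReal.ofReal (∫ σ in (0:ℝ)..1, ‖deriv γ' σ‖)) ≤
      ENNReal.ofReal (∫ σ in (0:ℝ)..1, ‖deriv γc σ‖) :=
    iInf₂_le γc hadm
  -- the length of the circle is at most 4πr
  have hlen : (∫ σ in (0:ℝ)..1, ‖deriv γc σ‖) ≤ 4 * Real.pi * r := by
    have hbound : ∀ σ ∈ Set.uIoc (0:ℝ) 1, ‖(fun σ => ‖deriv γc σ‖) σ‖ ≤ 4 * Real.pi * r := by
      intro σ _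
      have h1 : ‖(-(r * Real.sin (2 * Real.pi * σ))) • e₁ + (r * Real.cos (2 * Real.pi * σ)) • e₂‖ ≤ r + r := by
        refine (norm_add_le _ _).trans (add_le_add ?_ ?_)
        · rw [norm_smul, he₁, mul_one, norm_neg, Real.norm_eq_abs, abs_mul, abs_of_pos hr]
          exact mul_le_of_le_one_right hr.le (Real.abs_sin_le_one _)
        · rw [norm_smul, he₂, mul_one, Real.norm_eq_abs, abs_mul, abs_of_pos hr]
          exact mul_le_of_le_one_right hr.le (Real.abs_cos_le_one _)
      have h2 : ‖(2 * Real.pi : ℝ)‖ = 2 * Real.pi := by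
        rw [Real.norm_eq_abs, abs_of_pos Real.two_pi_pos]
      show ‖‖deriv γc σ‖‖ ≤ 4 * Real.pi * r
      rw [norm_norm, hγc, Literature.Analysis.FluidPDE.deriv_circleLoop, norm_smul, h2]
      have h3 := mul_le_mul_of_nonneg_left h1 Real.two_pi_pos.le
      linarith
    have h4 := intervalIntegral.norm_integral_le_of_norm_le_const hbound
    rw [sub_zero, abs_one, mul_one] at h4
    exact (Real.le_norm_self _).trans h4
  -- at time 0 every admissible loop is long: |∮u₀| ≤ sup|u₀| · length
  have hlower : ENNReal.ofReal (c₀ * ν / max C₀ 1) ≤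
      (⨅ (γ' : ℝ → EuclideanSpace ℝ (Fin 3)) (_ : Literature.Analysis.FluidPDE.IsC1Loop γ' ∧
        c₀ * ν ≤ |Literature.Analysis.FluidPDE.circulation (u 0) γ'|), ENNReal.ofReal (∫ σ in (0:ℝ)..1, ‖deriv γ' σ‖)) := by
    refine le_iInf₂ (fun γ hγ => ?_)
    apply ENNReal.ofReal_le_ofReal
    rw [div_le_iff₀ hCpos]
    have hγ1 := hγ.1
    have hcont : Continuous (u 0) := (hcl.contDiff_velocity ⟨le_rfl, hT⟩).continuous
    have hint_le : |Literature.Analysis.FluidPDE.circulation (u 0) γ| ≤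
        max C₀ 1 * ∫ σ in (0:ℝ)..1, ‖deriv γ σ‖ := by
      unfold Literature.Analysis.FluidPDE.circulation
      rw [← intervalIntegral.integral_const_mul]
      refine (intervalIntegral.abs_integral_le_integral_abs zero_le_one).trans ?_
      refine intervalIntegral.integral_mono_on zero_le_one ?_ ?_ (fun σ _ => ?_)
      · exact ((hcont.comp hγ1.continuous).inner hγ1.continuous_deriv).abs.intervalIntegrable 0 1
      · exact (continuous_const.mul hγ1.continuous_deriv.norm).intervalIntegrable 0 1
      · exact (abs_real_inner_le_norm _ _).trans (mul_le_mul_of_nonneg_right (hu0 _) (norm_nonneg _))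
    calc c₀ * ν ≤ |Literature.Analysis.FluidPDE.circulation (u 0) γ| := hγ.2
      _ ≤ max C₀ 1 * ∫ σ in (0:ℝ)..1, ‖deriv γ σ‖ := hint_le
      _ = (∫ σ in (0:ℝ)..1, ‖deriv γ σ‖) * max C₀ 1 := mul_comm _ _
  -- chain everything in ℝ≥0∞ and come back to ℝ
  have hchain : ENNReal.ofReal ρ ≤ ENNReal.ofReal (4 * Real.pi * r) := by
    calc ENNReal.ofReal ρ
        = ENNReal.ofReal (c₀ * ν / max C₀ 1) * ENNReal.ofReal (Real.exp (-M)) := by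
          rw [hρ, ENNReal.ofReal_mul (div_pos hgpos hCpos).le]
      _ ≤ (⨅ (γ' : ℝ → EuclideanSpace ℝ (Fin 3)) (_ : Literature.Analysis.FluidPDE.IsC1Loop γ' ∧
            c₀ * ν ≤ |Literature.Analysis.FluidPDE.circulation (u 0) γ'|), ENNReal.ofReal (∫ σ in (0:ℝ)..1, ‖deriv γ' σ‖)) *
            ENNReal.ofReal (Real.exp (-M)) := mul_le_mul_left hlower _
      _ ≤ (⨅ (γ' : ℝ → EuclideanSpace ℝ (Fin 3)) (_ : Literature.Analysis.FluidPDE.IsC1Loop γ' ∧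
            c₀ * ν ≤ |Literature.Analysis.FluidPDE.circulation (u t) γ'|), ENNReal.ofReal (∫ σ in (0:ℝ)..1, ‖deriv γ' σ‖)) := hlaw
      _ ≤ ENNReal.ofReal (∫ σ in (0:ℝ)..1, ‖deriv γc σ‖) := hupper
      _ ≤ ENNReal.ofReal (4 * Real.pi * r) := ENNReal.ofReal_le_ofReal hlen
  have hρle : ρ ≤ 4 * Real.pi * r :=
    (ENNReal.ofReal_le_ofReal_iff (mul_nonneg (by positivity) hr.le)).1 hchain
  -- contradiction with r ≤ ρ / (8π)
  have h5 : 4 * Real.pi * r ≤ ρ / 2 := by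
    have h6 := mul_le_mul_of_nonneg_left hrδ (by positivity : (0:ℝ) ≤ 4 * Real.pi)
    calc 4 * Real.pi * r ≤ 4 * Real.pi * (ρ / (8 * Real.pi)) := h6
      _ = ρ / 2 := by field_simp; ring
  linarith

/-- **K1 gives the Type-I piece** (stmt-1217): a solution of the class satisfies the hypothesis of the
per-solution criterion by K1, hence extends past `T` (the Type-I rate is not even used). [folklore] -/
theorem noTypeIBlowup_of_tautCompressionIntegrable (hK1 : Theses.TautLoopKelvin.TautCompressionIntegrable) :
    Theses.TypeICertificateLadder.NoTypeIBlowup := by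
  intro ν T hν hT u p hcl hLH hdec _hI
  exact hasSmoothExtensionPast_of_tautCompression hν hT hcl hLH hdec (hK1 ν T hν hT u p hcl hLH hdec)

/-- **K1 gives the Type-II piece** (stmt-0056): under K1 a maximal solution of the class cannot exist (the
criterion extends it), so the conclusion holds vacuously. [folklore] -/
theorem noTypeII_of_tautCompressionIntegrable (hK1 : Theses.TautLoopKelvin.TautCompressionIntegrable) :
    Theses.TypeICertificateLadder.NoTypeII := by
  intro ν T hν hT u p hmax hLH hdec
  exact absurd
    (hasSmoothExtensionPast_of_tautCompression hν hT hmax.1 hLH hdec (hK1 ν T hν hT u p hmax.1 hLH hdec)) hmax.2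

/-- **The rate split is exact**: `TautCompressionIntegrable ↔ NoTypeIBlowup ∧ NoTypeII`, unconditionally.
(With `SummitEquivalence.tautCompressionIntegrable_iff_navierStokesRegularity_of_tautLoopLaw` and the landed
`TautLoopLaw`, all three are equivalent to the summit; the two pieces are the classical open halves — no
blow-up at the self-similar rate, and no blow-up faster than it.) [folklore] -/
theorem tautCompressionIntegrable_iff_noTypeIBlowup_and_noTypeII :
    Theses.TautLoopKelvin.TautCompressionIntegrable ↔
      (Theses.TypeICertificateLadder.NoTypeIBlowup ∧ Theses.TypeICertificateLadder.NoTypeII) :=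
  ⟨fun h => ⟨noTypeIBlowup_of_tautCompressionIntegrable h, noTypeII_of_tautCompressionIntegrable h⟩,
    fun h => SummitEquivalence.tautCompressionIntegrable_of_noTypeIBlowup_of_noTypeII h.1 h.2⟩

/-- **The Type-I piece from the Type-I regime stub of the birth skeleton.** If the conclusion of K1 holds for
every solution of the class that does not extend past `T` and has the Type-I rate at `T` (registered stub
`stub_typeIBlowup_endgame`), then `NoTypeIBlowup`: for a Type-I solution either it extends (done) or the stub
applies at every level and the per-solution criterion extends it anyway. [folklore] -/
theorem noTypeIBlowup_of_typeIEndgame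
    (h3 : ∀ (ν T : ℝ), 0 < ν → 0 < T →
      ∀ (u : ℝ → EuclideanSpace ℝ (Fin 3) → EuclideanSpace ℝ (Fin 3)) (p : ℝ → EuclideanSpace ℝ (Fin 3) → ℝ),
      Literature.Analysis.FluidPDE.IsClassicalNSSolutionOn (Set.Ico 0 T) ν 0 u p →
      Literature.Analysis.FluidPDE.IsLerayHopfOn T ν 0 (u 0) u →
      Literature.Analysis.FluidPDE.HasRapidSpatialDecay (u 0) →
      ¬ Literature.Analysis.FluidPDE.HasSmoothExtensionPast ν 0 u T →
      Literature.Analysis.FluidPDE.IsTypeIBlowup u T →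
      ∀ g : ℝ, 0 < g → ∃ (Φ : ℝ → ℝ) (M : ℝ), Measurable Φ ∧ 0 ≤ M ∧
        (∀ s ∈ Set.Ioo 0 T, (⨅ ε : {ε : ℝ // 0 < ε}, sSup {k : ℝ | ∃ γ : ℝ → EuclideanSpace ℝ (Fin 3),
          Literature.Analysis.FluidPDE.IsC1Loop γ ∧ g ≤ |Literature.Analysis.FluidPDE.circulation (u s) γ| ∧
          ENNReal.ofReal (∫ σ in (0:ℝ)..1, ‖deriv γ σ‖) ≤
            (⨅ (γ' : ℝ → EuclideanSpace ℝ (Fin 3)) (_ : Literature.Analysis.FluidPDE.IsC1Loop γ' ∧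
              g ≤ |Literature.Analysis.FluidPDE.circulation (u s) γ'|), ENNReal.ofReal (∫ σ in (0:ℝ)..1, ‖deriv γ' σ‖)) +
            ENNReal.ofReal (ε : ℝ) ∧
          k = ((∫ σ in (0:ℝ)..1, -(inner ℝ (deriv γ σ) (fderiv ℝ (u s) (γ σ) (deriv γ σ))) / ‖deriv γ σ‖) /
            (∫ σ in (0:ℝ)..1, ‖deriv γ σ‖))}) ≤ Φ s) ∧
        (∫⁻ s in Set.Ioo 0 T, ENNReal.ofReal (Φ s)) ≤ ENNReal.ofReal M) :
    Theses.TypeICertificateLadder.NoTypeIBlowup := by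
  intro ν T hν hT u p hcl hLH hdec hI
  by_contra hext
  exact hext (hasSmoothExtensionPast_of_tautCompression hν hT hcl hLH hdec
    (h3 ν T hν hT u p hcl hLH hdec hext hI))

/-- **The Type-II piece from the non-Type-I regime stub of the birth skeleton.** If the conclusion of K1
holds for every solution of the class that does not extend past `T` and lacks the Type-I rate at `T`
(registered stub `stub_nonTypeIBlowup_endgame`), then `NoTypeII`: a maximal solution without the Type-I rate
would satisfy the stub at every level, and the per-solution criterion would extend it. [folklore] -/
theorem noTypeII_of_nonTypeIEndgame
    (h4 : ∀ (ν T : ℝ), 0 < ν → 0 < T →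
      ∀ (u : ℝ → EuclideanSpace ℝ (Fin 3) → EuclideanSpace ℝ (Fin 3)) (p : ℝ → EuclideanSpace ℝ (Fin 3) → ℝ),
      Literature.Analysis.FluidPDE.IsClassicalNSSolutionOn (Set.Ico 0 T) ν 0 u p →
      Literature.Analysis.FluidPDE.IsLerayHopfOn T ν 0 (u 0) u →
      Literature.Analysis.FluidPDE.HasRapidSpatialDecay (u 0) →
      ¬ Literature.Analysis.FluidPDE.HasSmoothExtensionPast ν 0 u T →
      ¬ Literature.Analysis.FluidPDE.IsTypeIBlowup u T →
      ∀ g : ℝ, 0 < g → ∃ (Φ : ℝ → ℝ) (M : ℝ), Measurable Φ ∧ 0 ≤ M ∧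
        (∀ s ∈ Set.Ioo 0 T, (⨅ ε : {ε : ℝ // 0 < ε}, sSup {k : ℝ | ∃ γ : ℝ → EuclideanSpace ℝ (Fin 3),
          Literature.Analysis.FluidPDE.IsC1Loop γ ∧ g ≤ |Literature.Analysis.FluidPDE.circulation (u s) γ| ∧
          ENNReal.ofReal (∫ σ in (0:ℝ)..1, ‖deriv γ σ‖) ≤
            (⨅ (γ' : ℝ → EuclideanSpace ℝ (Fin 3)) (_ : Literature.Analysis.FluidPDE.IsC1Loop γ' ∧
              g ≤ |Literature.Analysis.FluidPDE.circulation (u s) γ'|), ENNReal.ofReal (∫ σ in (0:ℝ)..1, ‖deriv γ' σ‖)) +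
            ENNReal.ofReal (ε : ℝ) ∧
          k = ((∫ σ in (0:ℝ)..1, -(inner ℝ (deriv γ σ) (fderiv ℝ (u s) (γ σ) (deriv γ σ))) / ‖deriv γ σ‖) /
            (∫ σ in (0:ℝ)..1, ‖deriv γ σ‖))}) ≤ Φ s) ∧
        (∫⁻ s in Set.Ioo 0 T, ENNReal.ofReal (Φ s)) ≤ ENNReal.ofReal M) :
    Theses.TypeICertificateLadder.NoTypeII := by
  intro ν T hν hT u p hmax hLH hdec
  by_contra hnI
  exact hmax.2 (hasSmoothExtensionPast_of_tautCompression hν hT hmax.1 hLH hdec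
    (h4 ν T hν hT u p hmax.1 hLH hdec hmax.2 hnI))

/-- **Piece 1 = regime 1.** `NoTypeIBlowup` (stmt-1217) is equivalent to the Type-I regime stub of the birth
skeleton of K1 (`Birth.typeIBlowup_endgame_of_noTypeIBlowup` and `noTypeIBlowup_of_typeIEndgame`). [folklore] -/
theorem noTypeIBlowup_iff_typeIEndgame :
    Theses.TypeICertificateLadder.NoTypeIBlowup ↔
    (∀ (ν T : ℝ), 0 < ν → 0 < T →
      ∀ (u : ℝ → EuclideanSpace ℝ (Fin 3) → EuclideanSpace ℝ (Fin 3)) (p : ℝ → EuclideanSpace ℝ (Fin 3) → ℝ),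
      Literature.Analysis.FluidPDE.IsClassicalNSSolutionOn (Set.Ico 0 T) ν 0 u p →
      Literature.Analysis.FluidPDE.IsLerayHopfOn T ν 0 (u 0) u →
      Literature.Analysis.FluidPDE.HasRapidSpatialDecay (u 0) →
      ¬ Literature.Analysis.FluidPDE.HasSmoothExtensionPast ν 0 u T →
      Literature.Analysis.FluidPDE.IsTypeIBlowup u T →
      ∀ g : ℝ, 0 < g → ∃ (Φ : ℝ → ℝ) (M : ℝ), Measurable Φ ∧ 0 ≤ M ∧
        (∀ s ∈ Set.Ioo 0 T, (⨅ ε : {ε : ℝ // 0 < ε}, sSup {k : ℝ | ∃ γ : ℝ → EuclideanSpace ℝ (Fin 3),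
          Literature.Analysis.FluidPDE.IsC1Loop γ ∧ g ≤ |Literature.Analysis.FluidPDE.circulation (u s) γ| ∧
          ENNReal.ofReal (∫ σ in (0:ℝ)..1, ‖deriv γ σ‖) ≤
            (⨅ (γ' : ℝ → EuclideanSpace ℝ (Fin 3)) (_ : Literature.Analysis.FluidPDE.IsC1Loop γ' ∧
              g ≤ |Literature.Analysis.FluidPDE.circulation (u s) γ'|), ENNReal.ofReal (∫ σ in (0:ℝ)..1, ‖deriv γ' σ‖)) +
            ENNReal.ofReal (ε : ℝ) ∧
          k = ((∫ σ in (0:ℝ)..1, -(inner ℝ (deriv γ σ) (fderiv ℝ (u s) (γ σ) (deriv γ σ))) / ‖deriv γ σ‖) /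
            (∫ σ in (0:ℝ)..1, ‖deriv γ σ‖))}) ≤ Φ s) ∧
        (∫⁻ s in Set.Ioo 0 T, ENNReal.ofReal (Φ s)) ≤ ENNReal.ofReal M) :=
  ⟨Birth.typeIBlowup_endgame_of_noTypeIBlowup, noTypeIBlowup_of_typeIEndgame⟩

/-- **Piece 2 = regime 2.** `NoTypeII` (stmt-0056) is equivalent to the non-Type-I regime stub of the birth
skeleton of K1 (`Birth.nonTypeIBlowup_endgame_of_noTypeII` and `noTypeII_of_nonTypeIEndgame`). [folklore] -/
theorem noTypeII_iff_nonTypeIEndgame :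
    Theses.TypeICertificateLadder.NoTypeII ↔
    (∀ (ν T : ℝ), 0 < ν → 0 < T →
      ∀ (u : ℝ → EuclideanSpace ℝ (Fin 3) → EuclideanSpace ℝ (Fin 3)) (p : ℝ → EuclideanSpace ℝ (Fin 3) → ℝ),
      Literature.Analysis.FluidPDE.IsClassicalNSSolutionOn (Set.Ico 0 T) ν 0 u p →
      Literature.Analysis.FluidPDE.IsLerayHopfOn T ν 0 (u 0) u →
      Literature.Analysis.FluidPDE.HasRapidSpatialDecay (u 0) →
      ¬ Literature.Analysis.FluidPDE.HasSmoothExtensionPast ν 0 u T →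
      ¬ Literature.Analysis.FluidPDE.IsTypeIBlowup u T →
      ∀ g : ℝ, 0 < g → ∃ (Φ : ℝ → ℝ) (M : ℝ), Measurable Φ ∧ 0 ≤ M ∧
        (∀ s ∈ Set.Ioo 0 T, (⨅ ε : {ε : ℝ // 0 < ε}, sSup {k : ℝ | ∃ γ : ℝ → EuclideanSpace ℝ (Fin 3),
          Literature.Analysis.FluidPDE.IsC1Loop γ ∧ g ≤ |Literature.Analysis.FluidPDE.circulation (u s) γ| ∧
          ENNReal.ofReal (∫ σ in (0:ℝ)..1, ‖deriv γ σ‖) ≤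
            (⨅ (γ' : ℝ → EuclideanSpace ℝ (Fin 3)) (_ : Literature.Analysis.FluidPDE.IsC1Loop γ' ∧
              g ≤ |Literature.Analysis.FluidPDE.circulation (u s) γ'|), ENNReal.ofReal (∫ σ in (0:ℝ)..1, ‖deriv γ' σ‖)) +
            ENNReal.ofReal (ε : ℝ) ∧
          k = ((∫ σ in (0:ℝ)..1, -(inner ℝ (deriv γ σ) (fderiv ℝ (u s) (γ σ) (deriv γ σ))) / ‖deriv γ σ‖) /
            (∫ σ in (0:ℝ)..1, ‖deriv γ σ‖))}) ≤ Φ s) ∧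
        (∫⁻ s in Set.Ioo 0 T, ENNReal.ofReal (Φ s)) ≤ ENNReal.ofReal M) :=
  ⟨Birth.nonTypeIBlowup_endgame_of_noTypeII, noTypeII_of_nonTypeIEndgame⟩

end Summit.NavierStokesRegularity.NavierStokesRegularity.Theorems.TautCompressionIntegrable.Split

end
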